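import Literature.NumberTheory.DiophantineGeometry.AbcWave0GranvilleStarkTheorem2Proofs
import Literature.NumberTheory.QuadraticFields.KroneckerCharacterFourProofs
import Literature.NumberTheory.QuadraticFields.JacobiCharacterPrimitiveProofs
import Literature.NumberTheory.QuadraticFields.FundamentalDiscriminant
import Literature.NumberTheory.QuadraticFields.DedekindZetaReducedForms
import HarnessLib

/-!
# Hallgren 2005 / class numbers under GRH — step N4b–c: reduced forms with a given first
# coefficient, and the classes lost to a divisor threshold

Topic `Literature/Computability/Cryptography`; proof companion of `HallgrenClassGroup.lean`
(named fact `Hallgren2005_classNumber_qsolvable_of_GRH`). Everything here is PROVED (theorems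
only; no definition, no named fact).

The random-forms sampler of the class-number algorithm draws `a ≤ A` and a square root `b` of
`d_K (mod 4a)`, giving the form `(a, b, ·)`; it gives up on the `a` whose number of divisors exceeds
a threshold `K'`. A class is reached through its reduced form `(a_C, b_C, c_C)`; this file bounds
how many reduced forms share a first coefficient and how many classes the threshold loses:

* `exists_sq_eq_one_dedekindZeta_eq` — every quadratic field has a QUADRATIC Kronecker character
  `κ` (`κ² = 1`) with `ζ_K = ζ · L(κ)` on `Re s > 1` (as in `HallgrenClassGroupERH.lean`, keeping
  quadraticity: `isQuadratic_jacobiChar`, `isQuadratic_of_forall_odd`);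
* `card_ideals_absNorm_eq_le_card_divisors` — `#{𝔞 : N𝔞 = n} ≤ τ(n)` for a quadratic field
  (`a_K(n) = ∑_{m ∣ n} κ(m)`, the tree's `charDivisorSum_eq_card`, and `|∑_{m ∣ n} κ(m)| ≤ τ(n)`);
* `card_reducedForms_fst_eq_le` — `#{Q ∈ reducedForms d_K : Q.1 = a} ≤ #{𝔞 : N𝔞 = a} ≤ τ(a)`
  (`Q ↦ 𝔞_Q = (a, ω − (b + t)/2)` is injective on reduced forms, being injective on classes,
  `reducedForms_mk0_bijective`; `N𝔞_Q = a`, `absNorm_span_pair_eq`);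
* `fst_le_sqrt_of_mem_reducedForms` — a reduced form has `a ≤ ⌊√(|D|/3)⌋` (`3a² ≤ |D|`);
* `card_reducedForms_threshold_mul_le` — **`K' · #{Q ∈ reducedForms d_K : τ(Q.1) > K'} ≤
  ∑_{a ≤ ⌊√(|d_K|/3)⌋} τ(a)²`** (with `HallgrenClassGroupDivisorSums.sum_card_divisors_sq_le` this is
  `≤ A(1 + log A)³`, `A = ⌊√(|d_K|/3)⌋`).

## References

* H. Davenport, *Multiplicative Number Theory*, GTM 74, Ch. 6 (`r(n) = ∑_{d ∣ n} χ(d)` counts the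
  ideals of norm `n`) [DavenportMNT1980].
* D. A. Cox, *Primes of the form x² + ny²*, 2nd ed. (2013), Thm. 7.7 [Cox2013].
* A. M. Childs, W. van Dam, Rev. Mod. Phys. 82 (2010), §5.7 [ChildsVandam2010].
-/

noncomputable section

open scoped MatrixGroups nonZeroDivisors NumberTheorySymbols
open Module NumberField Finset
open Literature.NumberTheory.EllipticCurves
open Literature.NumberTheory.QuadraticFields Literature.NumberTheory.QuadraticFields.Quadratic
open Literature.NumberTheory.QuadraticFields.BinaryQuadraticForm (reducedForms mem_reducedForms_iff
  discr_apply le_of_isReduced)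
open Literature.NumberTheory.LFunctions Literature.NumberTheory.DiophantineGeometry

namespace Literature.Computability.Cryptography.Hallgren2005

variable {K : Type*} [Field K] [NumberField K]

/-! ### A quadratic Kronecker character -/

/-- **Every quadratic field has a quadratic Kronecker character**: for `[K : ℚ] = 2` there is a
Dirichlet character `κ` with `κ² = 1` and `ζ_K(s) = ζ(s) L(s, κ)` on `Re s > 1` (odd `d_K`: the
Jacobi character mod `|d_K|`; even `d_K = 4m`: the character mod `4|m|` with `κ(n) = (m / n)` for odd
`n`, `exists_dirichletCharacter_four_mul`). [cite: DavenportMNT1980, Ch. 6] -/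
theorem exists_sq_eq_one_dedekindZeta_eq (h2 : finrank ℚ K = 2) :
    ∃ (M : ℕ) (_ : NeZero M) (κ : DirichletCharacter ℂ M), κ ^ 2 = 1 ∧
      ∀ s : ℂ, 1 < s.re → dedekindZeta K s = riemannZeta s * LSeries (fun n => κ n) s := by
  rcases Int.even_or_odd (NumberField.discr K) with hev | hodd
  · set D : ℤ := NumberField.discr K with hDdef
    obtain ⟨hD1, -, -⟩ | ⟨h4, -, hsq⟩ := Quadratic.isFundamentalDiscriminant_discr (K := K) h2
    · exfalso
      obtain ⟨k, hk⟩ := hev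
      omega
    have hm0 : D / 4 ≠ 0 := hsq.ne_zero
    have hDm : D = 4 * (D / 4) := (Int.mul_ediv_cancel' h4).symm
    haveI : NeZero (4 * (D / 4).natAbs) :=
      ⟨mul_ne_zero (by norm_num) (Int.natAbs_ne_zero.mpr hm0)⟩
    obtain ⟨κ, hκ⟩ := exists_dirichletCharacter_four_mul (D / 4) hm0
    refine ⟨4 * (D / 4).natAbs, inferInstance, κ, (isQuadratic_of_forall_odd hm0 hκ).sq_eq_one,
      fun s hs => Quadratic.dedekindZeta_eq_riemannZeta_mul_LSeries_of_kronecker h2 κ ?_ ?_ hs⟩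
    · intro p hp hp2
      have hpodd : Odd p := hp.odd_of_ne_two hp2
      have hgcd : Int.gcd (2 : ℤ) (p : ℤ) = 1 := by
        show Nat.gcd 2 p = 1
        exact Nat.coprime_two_left.mpr hpodd
      have h4' : J(4 * (D / 4) | p) = J(D / 4 | p) := by
        rw [jacobiSym.mul_left, show (4 : ℤ) = 2 ^ 2 by norm_num, jacobiSym.sq_one' hgcd, one_mul]
      rw [hκ p hpodd, ← hDdef, ← h4', ← hDm]
    · have hval : Even ((2 : ZMod (4 * (D / 4).natAbs)).val) := by
        have : Int.natAbs (D / 4) ≠ 0 := Int.natAbs_ne_zero.mpr hm0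
        rw [show (2 : ZMod (4 * (D / 4).natAbs)) = ((2 : ℕ) : ZMod (4 * (D / 4).natAbs)) by
          norm_cast, ZMod.val_natCast, Nat.mod_eq_of_lt (by omega)]
        exact even_two
      rw [apply_eq_zero_of_even (χ := κ) hval, ← hDdef]
      have h81 : ¬ D % 8 = 1 := by omega
      have h85 : ¬ D % 8 = 5 := by omega
      rw [if_neg h81, if_neg h85]
  · exact ⟨(NumberField.discr K).natAbs, inferInstance, jacobiChar (NumberField.discr K).natAbs,
      isQuadratic_jacobiChar.sq_eq_one,
      fun s hs => Quadratic.dedekindZeta_eq_riemannZeta_mul_LSeries h2 hodd hs⟩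

/-! ### Ideals of a given norm and reduced forms with a given first coefficient -/

/-- **`#{𝔞 : N𝔞 = n} ≤ τ(n)` in a quadratic field**: the number of ideals of norm `n ≠ 0` is
`∑_{m ∣ n} κ(m)` (`charDivisorSum_eq_card`, Davenport Ch. 6) and `|∑_{m ∣ n} κ(m)| ≤ τ(n)`
(`abs_charDivisorSum_le`). [cite: DavenportMNT1980, Ch. 6] -/
theorem card_ideals_absNorm_eq_le_card_divisors (h2 : finrank ℚ K = 2) {n : ℕ} (hn : n ≠ 0) :
    Nat.card {I : Ideal (𝓞 K) // Ideal.absNorm I = n} ≤ n.divisors.card := by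
  obtain ⟨M, _, κ, hκ2, hζ⟩ := exists_sq_eq_one_dedekindZeta_eq h2
  have h := charDivisorSum_eq_card (K := K) hκ2 hζ hn
  have hle := (le_abs_self _).trans (RealChar.abs_charDivisorSum_le κ n)
  rw [h] at hle
  exact_mod_cast hle

/-- A reduced form has `3a² ≤ |D|`, hence `a ≤ ⌊√(|D|/3)⌋`. [folklore] -/
theorem fst_le_sqrt_of_mem_reducedForms {D : ℤ} (hD : D < 0) {Q : ℤ × ℤ × ℤ}
    (hQ : Q ∈ reducedForms D) : Q.1.toNat ≤ Nat.sqrt (D.natAbs / 3) := by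
  obtain ⟨a, b, c⟩ := Q
  obtain ⟨hdisc, ha, -, hred⟩ := (mem_reducedForms_iff hD).1 hQ
  obtain ⟨-, hb1, hb2, hac⟩ := le_of_isReduced hdisc ha hred
  rw [discr_apply] at hdisc
  simp only at ha ⊢
  have hbb : b ^ 2 ≤ a ^ 2 := by nlinarith
  have h3a : 3 * a ^ 2 ≤ -D := by nlinarith
  have hnat : 3 * (a.toNat * a.toNat) ≤ D.natAbs := by
    have h1 : (a.toNat : ℤ) = a := Int.toNat_of_nonneg ha.le
    have h2 : (D.natAbs : ℤ) = -D := Int.ofNat_natAbs_of_nonpos hD.le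
    have : (3 * (a.toNat * a.toNat) : ℤ) ≤ D.natAbs := by rw [h1, h2]; nlinarith
    exact_mod_cast this
  rw [Nat.le_sqrt, Nat.le_div_iff_mul_le (by norm_num)]
  linarith

/-- **`#{Q ∈ reducedForms d_K : Q.1 = a} ≤ #{𝔞 : N𝔞 = a}`** for an imaginary quadratic field:
`Q = (a, b, c) ↦ 𝔞_Q = (a, ω − (b + t)/2)` has `N𝔞_Q = a` and is injective on reduced forms (its
composite with the class map is, `reducedForms_mk0_bijective`). [cite: Cox2013, §7.B Thm. 7.7] -/
theorem card_reducedForms_fst_eq_le_card_ideals (hK : IsImaginaryQuadratic K) (a : ℕ) :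
    ((reducedForms (NumberField.discr K)).filter (fun Q => Q.1 = (a : ℤ))).card ≤
      Nat.card {I : Ideal (𝓞 K) // Ideal.absNorm I = a} := by
  classical
  obtain ⟨b, hb⟩ := exists_basis_zero_eq_one (K := K) hK.1
  set m : ℤ := b.repr (b 1 * b 1) 0 with hm
  set t : ℤ := b.repr (b 1 * b 1) 1 with ht
  have hω : b 1 * b 1 = (m : 𝓞 K) + (t : 𝓞 K) * b 1 := basis_one_mul_self_eq b hb
  have hDK : NumberField.discr K = t ^ 2 + 4 * m := discr_eq_sq_add_four_mul b hb
  have hneg : t ^ 2 + 4 * m < 0 := hDK ▸ hK.discr_neg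
  have hD0 : NumberField.discr K < 0 := hK.discr_neg
  haveI : Finite {I : Ideal (𝓞 K) // Ideal.absNorm I = a} := (Ideal.finite_setOf_absNorm_eq a).to_subtype
  -- the map `Q ↦ 𝔞_Q` into the ideals of norm `a`
  let F : ((reducedForms (NumberField.discr K)).filter (fun Q => Q.1 = (a : ℤ))) →
      {I : Ideal (𝓞 K) // Ideal.absNorm I = a} := fun Q =>
    ⟨Ideal.span {((Q : ℤ × ℤ × ℤ).1 : 𝓞 K), b 1 - ((((Q : ℤ × ℤ × ℤ).2.1 + t) / 2 : ℤ) : 𝓞 K)}, by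
      obtain ⟨Q, hQ⟩ := Q
      obtain ⟨hQr, hQa⟩ := mem_filter.1 hQ
      obtain ⟨hdiscQ, hA, -, -⟩ := (mem_reducedForms_iff hD0).1 hQr
      rw [discr_apply] at hdiscQ
      have hdisc' : Q.2.1 ^ 2 - 4 * Q.1 * Q.2.2 = t ^ 2 + 4 * m := by rw [← hDK]; exact hdiscQ
      have h2k : 2 * ((Q.2.1 + t) / 2) = Q.2.1 + t := two_mul_ediv_two_of_disc_eq hdisc'
      have hn : Q.1 * Q.2.2 = ((Q.2.1 + t) / 2) ^ 2 - t * ((Q.2.1 + t) / 2) - m :=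
        norm_eq_of_disc_eq hdisc' h2k
      simp only
      rw [absNorm_span_pair_eq b hb hω hn, hQa, Int.natAbs_natCast]⟩
  have hF : Function.Injective F := by
    rintro ⟨Q, hQ⟩ ⟨Q', hQ'⟩ h
    have hQr : Q ∈ reducedForms (t ^ 2 + 4 * m) := hDK ▸ (mem_filter.1 hQ).1
    have hQr' : Q' ∈ reducedForms (t ^ 2 + 4 * m) := hDK ▸ (mem_filter.1 hQ').1
    have hI : (F ⟨Q, hQ⟩ : Ideal (𝓞 K)) = (F ⟨Q', hQ'⟩ : Ideal (𝓞 K)) := congrArg Subtype.val h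
    have hinj := (reducedForms_mk0_bijective b hb hω hneg).1
    have hsub : (⟨Q, hQr⟩ : reducedForms (t ^ 2 + 4 * m)) = ⟨Q', hQr'⟩ := by
      apply hinj
      simp only
      congr 1
      exact Subtype.ext hI
    have hQQ : Q = Q' := congrArg Subtype.val hsub
    exact Subtype.ext hQQ
  have h := Nat.card_le_card_of_injective F hF
  rwa [Nat.card_eq_fintype_card, Fintype.card_coe] at h

/-- Hence **`#{Q ∈ reducedForms d_K : Q.1 = a} ≤ τ(a)`** (`a ≥ 1`) for an imaginary quadratic
field. [cite: DavenportMNT1980, Ch. 6] -/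
theorem card_reducedForms_fst_eq_le (hK : IsImaginaryQuadratic K) {a : ℕ} (ha : a ≠ 0) :
    ((reducedForms (NumberField.discr K)).filter (fun Q => Q.1 = (a : ℤ))).card ≤ a.divisors.card :=
  (card_reducedForms_fst_eq_le_card_ideals hK a).trans (card_ideals_absNorm_eq_le_card_divisors hK.1 ha)

/-! ### The classes lost to a divisor threshold -/

/-- **`K' · #{Q ∈ reducedForms d_K : τ(Q.1) > K'} ≤ ∑_{a ≤ ⌊√(|d_K|/3)⌋} τ(a)²`**: sum over the first
coefficient `a` (`1 ≤ a ≤ ⌊√(|d_K|/3)⌋` for a reduced form), at most `τ(a)` reduced forms for each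
(`card_reducedForms_fst_eq_le`), each counted with weight `K' < τ(a)`. [folklore] -/
theorem card_reducedForms_threshold_mul_le (hK : IsImaginaryQuadratic K) (K' : ℕ) :
    K' * ((reducedForms (NumberField.discr K)).filter
        (fun Q => K' < (Q.1.toNat).divisors.card)).card ≤
      ∑ a ∈ Icc 1 (Nat.sqrt ((NumberField.discr K).natAbs / 3)), a.divisors.card ^ 2 := by
  classical
  set D : ℤ := NumberField.discr K with hDdef
  have hD0 : D < 0 := hK.discr_neg
  set A : ℕ := Nat.sqrt (D.natAbs / 3) with hA
  set Bad := (reducedForms D).filter (fun Q => K' < (Q.1.toNat).divisors.card) with hBad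
  -- fibre over the first coefficient
  have hmaps : ∀ Q ∈ Bad, Q.1.toNat ∈ Icc 1 A := by
    intro Q hQ
    obtain ⟨hQr, -⟩ := mem_filter.1 hQ
    have ha : 0 < Q.1 := ((mem_reducedForms_iff hD0).1 hQr).2.1
    rw [mem_Icc]
    exact ⟨by omega, fst_le_sqrt_of_mem_reducedForms hD0 hQr⟩
  have hcard : Bad.card = ∑ a ∈ Icc 1 A, (Bad.filter (fun Q => Q.1.toNat = a)).card :=
    card_eq_sum_card_fiberwise hmaps
  rw [hcard, mul_sum]
  refine sum_le_sum fun a haA => ?_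
  rw [mem_Icc] at haA
  have ha0 : a ≠ 0 := by omega
  -- the fibre is empty unless `K' < τ(a)`, and has at most `τ(a)` elements
  by_cases hKa : K' < a.divisors.card
  · have hsub : Bad.filter (fun Q => Q.1.toNat = a) ⊆ (reducedForms D).filter (fun Q => Q.1 = (a : ℤ)) := by
      intro Q hQ
      obtain ⟨hQB, hQa⟩ := mem_filter.1 hQ
      obtain ⟨hQr, -⟩ := mem_filter.1 hQB
      have ha' : 0 < Q.1 := ((mem_reducedForms_iff hD0).1 hQr).2.1
      refine mem_filter.2 ⟨hQr, ?_⟩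
      rw [← hQa, Int.toNat_of_nonneg ha'.le]
    calc K' * (Bad.filter (fun Q => Q.1.toNat = a)).card
        ≤ a.divisors.card * ((reducedForms D).filter (fun Q => Q.1 = (a : ℤ))).card :=
          Nat.mul_le_mul hKa.le (card_le_card hsub)
      _ ≤ a.divisors.card * a.divisors.card :=
          Nat.mul_le_mul_left _ (card_reducedForms_fst_eq_le hK ha0)
      _ = a.divisors.card ^ 2 := (sq _).symm
  · have hempty : Bad.filter (fun Q => Q.1.toNat = a) = ∅ := by
      refine filter_eq_empty_iff.mpr fun Q hQ hQa => hKa ?_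
      obtain ⟨-, hQK⟩ := mem_filter.1 hQ
      rwa [hQa] at hQK
    rw [hempty, card_empty, mul_zero]
    exact Nat.zero_le _

end Literature.Computability.Cryptography.Hallgren2005

end
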